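import Summits.AtomisticToContinuum.FouriersLaw.Theorems.LatticeLandauDampingAbelThermodynamicLimitFixedFrequencyMatchingAutocorrBound
import HarnessLib

/-!
# `stub_equalTimeBound` of line `series-law-at-every-laplace-frequency` (SketchIdeator2): the EARLY,
`N`-linear bound on the open chain's equilibrium current autocorrelation
(crux `LatticeLandauDamping.AbelThermodynamicLimit`, item stmt-AtomisticToContinuum-14013; `--supports` helper
file proving the registered stub `stub_equalTimeBound` — verbatim birth stub 1 of stmt-13416 and stub 1 of
the twin's `l1_tail_transport` (stmt-12596) — closes nothing)

For the OPEN pinned anharmonic chain `P = pinnedChain ω₂ lam β γ` (all parameters `> 0`) with both Langevin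
baths at `T > 0`, write `J = Σ_i j_i` for the total bond current and
`c_N(t) = ∫ J · (P_t J) dμ_{N,T}` for its equilibrium autocorrelation (Gibbs measure `gibbsMeasure N T`,
constructed kernels `transitionKernel N T T t`). The registered stub asks for `C` and `N₀` with
`|c_N(t)| ≤ C·N` for all `N ≥ N₀` and all `t > 0`.

This is an immediate corollary of the already-landed engine
`pinnedChain_abs_totalCurrentAutocorr_le_linear` (file
`LatticeLandauDampingAbelThermodynamicLimitFixedFrequencyMatchingAutocorrBound`), which gives `B ≥ 0` with
`|c_N(t)| ≤ B·N` for EVERY `N` and EVERY `t` (`⟨J, P_t J⟩ ≤ ‖J‖²_{L²(μ_{N,T})} ≤ 3MN`, `M` the `N`-uniform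
second-moment bound of the bond currents); we take `C = B`, `N₀ = 0`.

References: Bonetto–Lebowitz–Rey-Bellet 2000 §7; Cuneo–Eckmann–Hairer–Rey-Bellet 2018 (the kernels).
No named fact is used; nothing here closes the item.
-/

noncomputable section

open MeasureTheory ProbabilityTheory Filter Topology Set Function
open scoped NNReal ENNReal

namespace Summit.AtomisticToContinuum.FouriersLaw.Theorems.AbelThermodynamicLimit.SeriesLawAtEveryLaplaceFrequency

open Literature.MathematicalPhysics.KineticTheory.HeatConduction

/-- **Registered stub `stub_equalTimeBound`** (EARLY: `N`-linear bound on the equilibrium current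
autocorrelation; verbatim birth stub 1 of stmt-13416 and stub 1 of the twin's `l1_tail_transport`). For
`pinnedChain ω₂ lam β γ` (all `> 0`) and `T > 0` there are `C` and `N₀` such that for all `N ≥ N₀` and all
`t > 0`, `|c_N(t)| = |∫ J · (P_t J) dμ_{N,T}| ≤ C·N`, where `J = Σ_i j_i` is the total bond current of the open
`N`-chain. Proof: the engine `pinnedChain_abs_totalCurrentAutocorr_le_linear` (valid for all `N`, all `t`)
with `C = B`, `N₀ = 0`. [folklore] -/
theorem stub_equalTimeBound :
    ∀ ω₂ lam β γ : ℝ, 0 < ω₂ → 0 < lam → 0 < β → 0 < γ → ∀ T : ℝ, 0 < T → ∃ C : ℝ, ∃ N₀ : ℕ, ∀ N : ℕ, N₀ ≤ N → ∀ t : ℝ, 0 < t → let J : Literature.MathematicalPhysics.KineticTheory.HeatConduction.PhaseSpace N → ℝ := fun z => ∑ i : Fin N, (Literature.MathematicalPhysics.KineticTheory.HeatConduction.pinnedChain ω₂ lam β γ).bondCurrent N i z; |∫ z, J z * (∫ y, J y ∂((Literature.MathematicalPhysics.KineticTheory.HeatConduction.pinnedChain ω₂ lam β γ).transitionKernel N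 T T t.toNNReal z)) ∂((Literature.MathematicalPhysics.KineticTheory.HeatConduction.pinnedChain ω₂ lam β γ).gibbsMeasure N T)| ≤ C * N := by
  intro ω₂ lam β γ hω hl hβ hγ T hT
  obtain ⟨B, -, hB⟩ := pinnedChain_abs_totalCurrentAutocorr_le_linear hω hl hβ hγ hT
  exact ⟨B, 0, fun N _ t _ => hB N t⟩

end Summit.AtomisticToContinuum.FouriersLaw.Theorems.AbelThermodynamicLimit.SeriesLawAtEveryLaplaceFrequency

end
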